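import Summits.CriticalPhenomena.SAWScalingLimit.Theses.SAWLoopFugacityFlow
import Summits.CriticalPhenomena.SAWScalingLimit.Theorems.SimpleSubseqLimits.Negative.SimpleSubseqLimitsCore
import Summits.CriticalPhenomena.SAWScalingLimit.Theorems.SAWLoopFugacityFlowSimpleSubseqLimitsStubShadowPassage
import Summits.CriticalPhenomena.SAWScalingLimit.Theorems.SAWLoopFugacityFlowSimpleSubseqLimitsStubShadowGlue
import Summits.CriticalPhenomena.SAWScalingLimit.Theorems.SAWLoopFugacityFlowSimpleSubseqLimitsStubRangeIsArc
import Summits.CriticalPhenomena.SAWScalingLimit.Theorems.SimpleSubseqLimits.Negative.SimpleSubseqLimitsNecessary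
import Summits.CriticalPhenomena.SAWScalingLimit.Theorems.SAWLoopFugacityFlowSimpleSubseqLimitsPSStubDecomposition
import Summits.CriticalPhenomena.SAWScalingLimit.Theorems.SAWLoopFugacityFlowSimpleSubseqLimitsPSShadowDecayPinned
import Literature.Probability.RandomPlanarGeometry.LoewnerRegularCurves
import Literature.Probability.RandomPlanarGeometry.HullSubdomainPullback
import Literature.Probability.RandomPlanarGeometry.CaratheodoryHalfPlaneProofs
import Literature.Probability.RandomPlanarGeometry.RestrictionHullsProofs
import Literature.Probability.RandomPlanarGeometry.RestrictionHullsRiemannProofs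
import Literature.Probability.RandomPlanarGeometry.SLEExistenceNeEightHolds
import Literature.Probability.RandomPlanarGeometry.JordanDomainProofs
import HarnessLib

/-!
# Line `past-shadowing-costs-halves` (crux `SAWLoopFugacityFlow.SimpleSubseqLimits`, stmt-CriticalPhenomena-4982):
the MAIN THEOREM of the line — the crux from its two lattice inputs, and the converse

Lead prover c1 (2026-08-16). This is the sorry-free composition of the reshaped (root-free) line,
landed so that it is importable (the crux workfile `Cruxes/SimpleSubseqLimits/Lines/past_shadowing_costs_halves.lean`
keeps the two open inputs as its only `sorry`s):

* `line_main : RootReturn → SlitShadowDecay → AvoidanceLimit → AvoidancePassage → SLEAvoidanceValue → SimpleSubseqLimits`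
  (registered stub `line_main`): ORDER — the decomposition `stub_decomposition` (landed,
  `…PSStubDecomposition.lean`) turns the two inputs into polyline shadow decay, which is class-level
  shadow decay (`shadowDecay_of_polyline`, open events are saturated), which passes to every
  subsequential weak limit (`ShadowPassage.stub_shadowPassage`, landed by the sibling line): `ν`(shadow
  events) `= 0`; SHAPE — the three route items give the hull-avoidance values of `ν`
  (`avoidanceValues_of_routeItems` = the sibling's landed `Glue.avoidanceAgree_of_routeItems`), hence `ν`-a.e. the range is an SLE(8/3) arc
  (`rangeArc_of_avoidanceValues`, from the first lead's landed `ArcRangeGlue.stub_rangeIsArc`); GLUE —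
  arc range + no shadowing ⇒ simple (`ShadowGlue.mem_simple_of_arc_of_notMem_shadowEvent`, landed), and the
  landed core equivalence `Negative.simpleSubseqLimits_iff_core` closes the crux.
* `line_main_routeNeutral : RootReturn → SlitShadowDecay → AvoidanceValues → SimpleSubseqLimits` — the same
  for the routes that feed the avoidance values from their own cruxes (SAWTensorRG, SAWFrontierHomotopy).
* `crux_iff_shadowDecay : EventualTight → A-side → (SimpleSubseqLimits ↔ ShadowDecay)`: with the landed pin
  `ShadowDecayPinned.shadowDecay_of_crux` the sibling line's single input is EQUIVALENT to the crux modulo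
  tightness (stmt-CriticalPhenomena-1372) and the route's A-side items; with `RootReturnPinned.inputs_of_crux`
  (`…PSRootReturnPinned.lean`) the same holds for this line's pair (RootReturn, SlitShadowDecay): the lines
  re-express the crux on the lattice at polyline level, losing nothing.

The vocabulary is that of the landed files (`Decomposition.RootReturn/SlitShadowDecay/PolylineShadowDecay`,
`ShadowDecayPinned.ShadowDecay`, `ShadowPassage.shadowEvent/nearShadowEvent`); the copies kept by the
sibling files agree with these by `rfl`.
-/

noncomputable section

open MeasureTheory Filter Topology Set Metric Function
open Literature.Probability.RandomPlanarGeometry Literature.Probability.RandomPlanarGeometry.SAW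
open Literature.Probability.LatticeModels
open scoped ENNReal NNReal BoundedContinuousFunction unitInterval

namespace Summit.CriticalPhenomena.SAWScalingLimit.Theorems.SimpleSubseqLimits.PastShadowing.Main

open Summit.CriticalPhenomena.SAWScalingLimit.Theses.SAWLoopFugacityFlow
  (SimpleSubseqLimits AvoidanceLimit AvoidancePassage SLEAvoidanceValue EventualTight)
open Summit.CriticalPhenomena.SAWScalingLimit.Theorems.SimpleSubseqLimits.Negative
  (WeakLimitAlong simpleSubseqLimits_iff_core ae_source_target_range_of_weakLimitAlong)
open Summit.CriticalPhenomena.SAWScalingLimit.Theorems.SimpleSubseqLimits.MarkedPointRevisit.ShadowPassage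
  (shadowEvent nearShadowEvent stub_shadowPassage setOf_nearShadows_latticeCurve)
open Summit.CriticalPhenomena.SAWScalingLimit.Theorems.SimpleSubseqLimits.MarkedPointRevisit.ShadowGlue
  (mem_simple_of_arc_of_notMem_shadowEvent)
open Summit.CriticalPhenomena.SAWScalingLimit.Theorems.SimpleSubseqLimits.MarkedPointRevisit.Glue
  (avoidanceAgree_of_routeItems)
open Summit.CriticalPhenomena.SAWScalingLimit.Theorems.SimpleSubseqLimits.PastShadowing.Decomposition
  (RootReturn SlitShadowDecay PolylineShadowDecay stub_decomposition latticeCurve)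
open Summit.CriticalPhenomena.SAWScalingLimit.Theorems.SimpleSubseqLimits.PastShadowing.Core (NearShadows)
open Summit.CriticalPhenomena.SAWScalingLimit.Theorems.SimpleSubseqLimits.PastShadowing.ShadowDecayPinned
  (ShadowDecay shadowDecay_of_crux)

/-! ## Limit-level statements (verbatim the skeleton) -/

/-- **Hull-avoidance values of subsequential limits** (route-neutral form of the SHAPE input; in route
SAWLoopFugacityFlow / SAWSteinDefect it is `AvoidanceLimit` + `AvoidancePassage` + `SLEAvoidanceValue`,
`avoidanceValues_of_routeItems`). Verbatim the skeleton's `AvoidanceValues` (deliberately untagged). -/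
def AvoidanceValues : Prop :=
  ∀ (D : DobrushinDomain) (a b : ℝ → Site 2), IsEndpointApprox D a b →
    ∀ (s : ℕ → ℝ) (ν : Measure (CurveClass ℂ)), Tendsto s atTop (𝓝[>] (0 : ℝ)) →
      IsProbabilityMeasure ν → WeakLimitAlong D a b s ν →
        ∃ μ : Measure (CurveClass ℂ), IsSLELaw ((8 : ℝ≥0) / 3) D μ ∧
          ∀ D' : DobrushinDomain, D'.carrier ⊆ D.carrier → D'.pt 0 = D.pt 0 → D'.pt 1 = D.pt 1 →
            (∃ ε : ℝ, 0 < ε ∧ D'.carrier ∩ ball (D.pt 0) ε = D.carrier ∩ ball (D.pt 0) ε ∧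
              D'.carrier ∩ ball (D.pt 1) ε = D.carrier ∩ ball (D.pt 1) ε) →
            ν (CurveClass.rangeSubset (closure D'.carrier)) =
              μ (CurveClass.rangeSubset (closure D'.carrier))

/-- **SHAPE** (`RangeArc`): `ν`-a.e. class has the range of a simple arc from `a` to `b` meeting `∂D` only
at `a, b`. Verbatim the skeleton's `RangeArc` (deliberately untagged). -/
def RangeArc : Prop :=
  ∀ (D : DobrushinDomain) (a b : ℝ → Site 2), IsEndpointApprox D a b →
    ∀ (s : ℕ → ℝ) (ν : Measure (CurveClass ℂ)), Tendsto s atTop (𝓝[>] (0 : ℝ)) →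
      IsProbabilityMeasure ν → WeakLimitAlong D a b s ν →
        ∀ᵐ c ∂ν, (∃ e : C(I, ℂ), Injective e ∧ range e = c.range ∧ e 0 = D.pt 0 ∧ e 1 = D.pt 1) ∧
          c.range ∩ frontier D.carrier ⊆ {D.pt 0, D.pt 1}

/-- **ORDER** (`NoShadowing`): every subsequential weak limit gives mass `0` to shadowing. Verbatim the
skeleton's `NoShadowing`, over the landed `ShadowPassage.shadowEvent` (deliberately untagged). -/
def NoShadowing : Prop :=
  ∀ (D : DobrushinDomain) (a b : ℝ → Site 2), IsEndpointApprox D a b →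
    ∀ (s : ℕ → ℝ) (ν : Measure (CurveClass ℂ)), Tendsto s atTop (𝓝[>] (0 : ℝ)) →
      IsProbabilityMeasure ν → WeakLimitAlong D a b s ν →
        ∀ η ρ : ℝ, 0 < η → 0 < ρ → ν (shadowEvent η ρ) = 0

/-! ## SHAPE and the limit passage, glued from the landed siblings -/

/-- **SHAPE** (`AvoidanceValues → RangeArc`), glued from the first lead's landed
`ArcRangeGlue.stub_rangeIsArc` (p91256). [folklore] -/
theorem rangeArc_of_avoidanceValues : AvoidanceValues → RangeArc := by
  intro hAV D a b hab s ν hs hν hw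
  haveI := hν
  obtain ⟨μ, hμ, hagree⟩ := hAV D a b hab s ν hs hν hw
  haveI : Fact Literature.Probability.Process.isProjectiveLimit_preWienerMeasure :=
    ⟨isProjectiveLimit_preWienerMeasure_holds⟩
  haveI := hμ.isProbabilityMeasure
  have hμcar := Summit.CriticalPhenomena.SAWScalingLimit.Theorems.SimpleSubseqLimits.Negative.ae_carrier_of_isSLELaw hμ
  have hfree := ae_source_target_range_of_weakLimitAlong (ν := ν) hab hs hw
  have h := Summit.CriticalPhenomena.SAWScalingLimit.Theorems.SimpleSubseqLimits.MarkedPointRevisit.ArcRangeGlue.stub_rangeIsArc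
    D ν μ hν inferInstance hfree hμcar hagree
  filter_upwards [h] with c hc
  obtain ⟨c', hc's, h0, h1, -, hfr, hrange⟩ := hc
  obtain ⟨e₀, he₀, rfl⟩ := hc's
  refine ⟨⟨e₀.toContinuousMap, he₀, ?_, ?_, ?_⟩, hrange ▸ hfr⟩
  · rw [← hrange]; rfl
  · change e₀ 0 = D.pt 0
    rw [← Curve.source_def, ← CurveClass.source_mk]; exact h0
  · change e₀ 1 = D.pt 1
    rw [← Curve.target_def, ← CurveClass.target_mk]; exact h1

/-- **LIMIT PASSAGE** (`ShadowDecay → NoShadowing`), glued from the sibling line's landed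
`ShadowPassage.stub_shadowPassage` (vocabulary agreeing by `rfl`). [folklore] -/
theorem noShadowing_of_shadowDecay : ShadowDecay → NoShadowing :=
  fun h D a b hab s ν hs hν hw η ρ hη hρ =>
    stub_shadowPassage D a b s ν (h D a b hab) ⟨hs, hν, hw⟩ η ρ hη hρ

/-! ## The SHAPE input from the route items (the sibling line's landed glue) -/

/-- **The route delivers `AvoidanceValues`** (`AvoidanceLimit` stmt-10649, `AvoidancePassage` stmt-4984,
`SLEAvoidanceValue` stmt-10651): this is the sibling line's landed `Glue.avoidanceAgree_of_routeItems`
(`AvoidanceValues` unfolds to `∃ μ, IsSLELaw (8/3) D μ ∧ Glue.AvoidanceAgree D ν μ` along `Glue.IsSubseqLimit`).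
[folklore] -/
theorem avoidanceValues_of_routeItems (hA : AvoidanceLimit) (hP : AvoidancePassage)
    (hV : SLEAvoidanceValue) : AvoidanceValues :=
  fun _D _a _b hab _s _ν hs hν hw => avoidanceAgree_of_routeItems hA hP hV hab ⟨hs, hν, hw⟩

/-! ## Class-level shadow decay is the polyline-level one -/

/-- **Class-level shadow decay IS the polyline-level one**: the lattice event
`{γ | γ.curve ∈ nearShadowEvent η ρ ε}` equals `{γ | NearShadows (latticeCurve γ) η ρ ε}` (open sets of
curves are saturated for distance zero, `ShadowPassage.setOf_nearShadows_latticeCurve`). [folklore] -/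
theorem shadowDecay_of_polyline (hP : PolylineShadowDecay) : ShadowDecay := by
  intro D a b hab η ρ θ hη hρ hθ
  obtain ⟨ε, hε, hev⟩ := hP D a b hab η ρ θ hη hρ hθ
  refine ⟨ε, hε, ?_⟩
  filter_upwards [hev] with δ hδ
  have key : {γ : DomainSAW D.carrier δ (a δ) (b δ) | NearShadows (latticeCurve γ) η ρ ε} =
      {γ | γ.curve ∈ ShadowDecayPinned.nearShadowEvent η ρ ε} :=
    setOf_nearShadows_latticeCurve η ρ ε
  rw [← key]
  exact hδ

/-! ## The composition -/

/-- **Crux from class-level shadow decay and the avoidance values** (the common final segment of both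
live lines): ORDER gives `NoShadowing`, SHAPE gives `RangeArc`; the landed core equivalence reduces the
crux to `ν`-a.s. simple ∧ boundary-avoiding; simplicity is `mem_simple_of_arc_of_notMem_shadowEvent`
applied `ν`-a.e. (countably many null shadow events; free endpoint clauses). [folklore] -/
theorem simpleSubseqLimits_of_shadowDecay_of_avoidanceValues (hSD : ShadowDecay)
    (hAV : AvoidanceValues) :
    Summit.CriticalPhenomena.SAWScalingLimit.Theses.SAWLoopFugacityFlow.SimpleSubseqLimits := by
  have hNS : NoShadowing := noShadowing_of_shadowDecay hSD
  have hRA : RangeArc := rangeArc_of_avoidanceValues hAV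
  refine simpleSubseqLimits_iff_core.2 fun D a b hab s ν hs hν hw => ?_
  have hra := hRA D a b hab s ν hs hν hw
  have hfree := ae_source_target_range_of_weakLimitAlong hab hs hw
  have hns : ∀ k : ℕ, ∀ᵐ c ∂ν, c ∉ shadowEvent (1 / ((k : ℝ) + 1)) (1 / ((k : ℝ) + 1)) :=
    fun k => measure_eq_zero_iff_ae_notMem.1
      (hNS D a b hab s ν hs hν hw _ _ (by positivity) (by positivity))
  rw [← ae_all_iff] at hns
  filter_upwards [hra, hfree, hns] with c hc hf hn
  obtain ⟨⟨e, he, hrange, he0, he1⟩, hfr⟩ := hc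
  exact ⟨mem_simple_of_arc_of_notMem_shadowEvent c e he hrange (he0.trans hf.1.symm)
    (he1.trans hf.2.1.symm) hn, hfr⟩

/-- **MAIN THEOREM of the line `past-shadowing-costs-halves` (registered stub `line_main`)**: the crux
from the two lattice inputs `RootReturn`, `SlitShadowDecay` and the route items `AvoidanceLimit`,
`AvoidancePassage`, `SLEAvoidanceValue`. [folklore] -/
theorem line_main : RootReturn → SlitShadowDecay → AvoidanceLimit → AvoidancePassage → SLEAvoidanceValue → SimpleSubseqLimits :=
  fun h₁ h₂ hA hP hV =>
    simpleSubseqLimits_of_shadowDecay_of_avoidanceValues (shadowDecay_of_polyline (stub_decomposition h₁ h₂))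
      (avoidanceValues_of_routeItems hA hP hV)

/-- Route-neutral form of the main theorem (for the routes feeding the avoidance values from their own
cruxes). [folklore] -/
theorem line_main_routeNeutral : RootReturn → SlitShadowDecay → AvoidanceValues → SimpleSubseqLimits :=
  fun h₁ h₂ hAV =>
    simpleSubseqLimits_of_shadowDecay_of_avoidanceValues (shadowDecay_of_polyline (stub_decomposition h₁ h₂)) hAV

/-- **The sibling line's single input is the crux too, modulo the same**: under `EventualTight` and the
route items, `SimpleSubseqLimits ↔ ShadowDecay` (`→`: `ShadowDecayPinned.shadowDecay_of_crux`; `←`: the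
common final segment). [folklore] -/
theorem crux_iff_shadowDecay (hT : EventualTight) (hA : AvoidanceLimit) (hP : AvoidancePassage)
    (hV : SLEAvoidanceValue) : SimpleSubseqLimits ↔ ShadowDecay :=
  ⟨fun hS => shadowDecay_of_crux hT hS, fun h =>
    simpleSubseqLimits_of_shadowDecay_of_avoidanceValues h (avoidanceValues_of_routeItems hA hP hV)⟩

end Summit.CriticalPhenomena.SAWScalingLimit.Theorems.SimpleSubseqLimits.PastShadowing.Main

end
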